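import Mathlib

/-!
# Pointwise minorants on `[t₂, ∞)` and `[log 2, ∞)`: stub `stub_regionThreeFour` of the line `Sketch`
(crux stmt-RiemannHypothesis-16305, `SignCone.SignConeFarField`, plastic-weight bookkeeping)

With `A = Re F(0) ≥ 0`, `σ = Re F(x) + Re F(-x)` and Bombieri's integrand
`h(A, σ, x) = σ (e^{-x/2} + e^{x/2}) − (e^{x/2} σ − 2A) / (2 sinh x)`, one has for `x > 0` the identity
`h = σ·w + A / sinh x` with the weight `w = e^{-x/2} + e^{x/2} − e^{x/2} / (2 sinh x)`; writing
`u = e^{x/2}` (so `2 sinh x = (u⁴ − 1)/u²`), `w = (u⁶ − u² − 1) / (u (u⁴ − 1))`, which is `≥ 0` as soon as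
`u⁶ ≥ u² + 1` (true for `u ≥ 7/6` and a fortiori for `u² ≥ 2`).

* Part (iii) (`x ≥ t₂ = 2 log(7/6)`, `σ ≥ −2A`): `h − A·φ₃ = (σ + 2A)·w + A·u(u−1)(36u² − 49)/(85(u²+1)) ≥ 0`
  for the arctan-free minorant `φ₃ = u/(u−1) − (36/85) u (u−1) − 2u − 2/u`.
* Part (iv) (`x ≥ log 2`, `σ ≥ 0`): `h − A / sinh x = σ·w ≥ 0`.

Both parts are reduced to the rational identities above (`field_simp; ring`) after the substitutions
`e^{-x/2} = u⁻¹`, `sinh x = (u² − u⁻²)/2` (`Real.exp_neg`, `Real.sinh_eq`, `Real.exp_add`).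
-/

noncomputable section

-- `Summit.RiemannHypothesis.RiemannHypothesis.…` repeats a namespace component by design (D-0017 layout).
set_option linter.dupNamespace false

namespace Summit.RiemannHypothesis.RiemannHypothesis.Theorems.SignConeFarField

/-- The plastic-number sign condition of Bombieri's weight for `u ≥ 7/6`: `u⁶ ≥ u² + 1`. -/
private lemma weight_num_nonneg_of_ge {u : ℝ} (hu : 7 / 6 ≤ u) : 0 ≤ u ^ 6 - u ^ 2 - 1 := by
  have hu0 : 0 ≤ u := by linarith
  have hy : 0 ≤ u ^ 2 - 49 / 36 := by nlinarith
  nlinarith [mul_nonneg (mul_nonneg hy hy) hy, mul_nonneg hy hy, hy]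

/-- The sign condition of Bombieri's weight for `u² ≥ 2`: `u⁶ ≥ u² + 1`. -/
private lemma weight_num_nonneg_of_sq_ge {u : ℝ} (hu : 2 ≤ u ^ 2) : 0 ≤ u ^ 6 - u ^ 2 - 1 := by
  have hy : 0 ≤ u ^ 2 - 2 := by linarith
  nlinarith [mul_nonneg (mul_nonneg hy hy) hy, mul_nonneg hy hy, hy]

/-- `2 sinh x` in terms of `u = e^{x/2}`: `2 · ((u² − u⁻²)/2) = (u⁴ − 1)/u²`. -/
private lemma two_sinh_eq {u : ℝ} (hu0 : u ≠ 0) :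
    2 * ((u ^ 2 - (u ^ 2)⁻¹) / 2) = (u ^ 4 - 1) / u ^ 2 := by
  field_simp

/-- `sinh x` in terms of `u = e^{x/2}`: `(u² − u⁻²)/2 = (u⁴ − 1)/(2u²)`. -/
private lemma sinh_eq' {u : ℝ} (hu0 : u ≠ 0) :
    (u ^ 2 - (u ^ 2)⁻¹) / 2 = (u ^ 4 - 1) / (2 * u ^ 2) := by
  field_simp

/-- Part (iii) in the variable `u = e^{x/2} ≥ 7/6`:
`A·φ₃(u) ≤ h`, via `h − A·φ₃ = (σ + 2A)·w + A·u(u−1)(36u² − 49)/(85(u²+1))`. -/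
private lemma region_three_core {A σ u : ℝ} (hA : 0 ≤ A) (hσ : -(2 * A) ≤ σ) (hu : 7 / 6 ≤ u) :
    A * (u / (u - 1) - 36 / 85 * (u * (u - 1)) - 2 * u - 2 * u⁻¹) ≤
      σ * (u⁻¹ + u) - (u * σ - 2 * A) / (2 * ((u ^ 2 - (u ^ 2)⁻¹) / 2)) := by
  have hu0 : 0 < u := by linarith
  have hu1 : 0 < u - 1 := by linarith
  have hu2 : 0 < u ^ 2 - 1 := by nlinarith
  have hu4 : 0 < u ^ 4 - 1 := by nlinarith [mul_pos hu2 (by positivity : (0 : ℝ) < u ^ 2 + 1)]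
  have hu0' : u ≠ 0 := hu0.ne'
  have hu1' : u - 1 ≠ 0 := hu1.ne'
  have hu4' : u ^ 4 - 1 ≠ 0 := hu4.ne'
  have hw : 0 ≤ u ^ 6 - u ^ 2 - 1 := weight_num_nonneg_of_ge hu
  have hg : 0 ≤ 36 * u ^ 2 - 49 := by nlinarith
  rw [two_sinh_eq hu0']
  have key : σ * (u⁻¹ + u) - (u * σ - 2 * A) / ((u ^ 4 - 1) / u ^ 2) -
      A * (u / (u - 1) - 36 / 85 * (u * (u - 1)) - 2 * u - 2 * u⁻¹) =
      (σ + 2 * A) * ((u ^ 6 - u ^ 2 - 1) / (u * (u ^ 4 - 1))) +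
        A * (u * (u - 1) * (36 * u ^ 2 - 49) / (85 * (u ^ 2 + 1))) := by
    field_simp
    ring
  have hnonneg : 0 ≤ (σ + 2 * A) * ((u ^ 6 - u ^ 2 - 1) / (u * (u ^ 4 - 1))) +
      A * (u * (u - 1) * (36 * u ^ 2 - 49) / (85 * (u ^ 2 + 1))) := by
    apply add_nonneg
    · exact mul_nonneg (by linarith) (div_nonneg hw (mul_pos hu0 hu4).le)
    · exact mul_nonneg hA (div_nonneg (mul_nonneg (mul_nonneg hu0.le hu1.le) hg) (by positivity))
  linarith [key, hnonneg]

/-- Part (iv) in the variable `u = e^{x/2}` with `u² ≥ 2`: `A / sinh x ≤ h`, via `h − A / sinh x = σ·w`. -/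
private lemma region_four_core {A σ u : ℝ} (hσ : 0 ≤ σ) (hu0 : 0 < u) (hu : 2 ≤ u ^ 2) :
    A / ((u ^ 2 - (u ^ 2)⁻¹) / 2) ≤
      σ * (u⁻¹ + u) - (u * σ - 2 * A) / (2 * ((u ^ 2 - (u ^ 2)⁻¹) / 2)) := by
  have hu1 : 1 < u := by nlinarith
  have hu4 : 0 < u ^ 4 - 1 := by nlinarith
  have hu0' : u ≠ 0 := hu0.ne'
  have hu4' : u ^ 4 - 1 ≠ 0 := hu4.ne'
  have hw : 0 ≤ u ^ 6 - u ^ 2 - 1 := weight_num_nonneg_of_sq_ge hu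
  rw [two_sinh_eq hu0', sinh_eq' hu0']
  have key : σ * (u⁻¹ + u) - (u * σ - 2 * A) / ((u ^ 4 - 1) / u ^ 2) - A / ((u ^ 4 - 1) / (2 * u ^ 2)) =
      σ * ((u ^ 6 - u ^ 2 - 1) / (u * (u ^ 4 - 1))) := by
    field_simp
    ring
  have hnonneg : 0 ≤ σ * ((u ^ 6 - u ^ 2 - 1) / (u * (u ^ 4 - 1))) :=
    mul_nonneg hσ (div_nonneg hw (mul_pos hu0 hu4).le)
  linarith [key, hnonneg]

/-- `e^x = (e^{x/2})²`. -/
private lemma exp_eq_sq_half (x : ℝ) : Real.exp x = Real.exp (x / 2) ^ 2 := by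
  rw [sq, ← Real.exp_add, add_halves]

/-- `sinh x = (u² − u⁻²)/2` with `u = e^{x/2}`. -/
private lemma sinh_eq_half (x : ℝ) :
    Real.sinh x = (Real.exp (x / 2) ^ 2 - (Real.exp (x / 2) ^ 2)⁻¹) / 2 := by
  rw [Real.sinh_eq, Real.exp_neg, exp_eq_sq_half]

/-- **Stub (pointwise minorants on `[t₂, ∞)` and on `[log 2, ∞)`).** With
`h(A, σ, x) = σ (e^{-x/2} + e^{x/2}) − (e^{x/2} σ − 2A)/(2 sinh x)` and `u = e^{x/2}`:
(iii) for `A ≥ 0`, `σ ≥ −2A`, `x ≥ 2 log(7/6)`: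
`A · (u/(u−1) − (36/85) u (u−1) − 2u − 2/u) ≤ h(A, σ, x)`;
(iv) for `σ ≥ 0`, `x ≥ log 2`: `A / sinh x ≤ h(A, σ, x)`. -/
theorem stub_regionThreeFour :
    (∀ A σ x : ℝ, 0 ≤ A → -(2 * A) ≤ σ → 2 * Real.log (7 / 6) ≤ x →
      A * (Real.exp (x / 2) / (Real.exp (x / 2) - 1) - 36 / 85 * (Real.exp (x / 2) * (Real.exp (x / 2) - 1)) -
          2 * Real.exp (x / 2) - 2 * Real.exp (-(x / 2))) ≤
        σ * (Real.exp (-(x / 2)) + Real.exp (x / 2)) - (Real.exp (x / 2) * σ - 2 * A) / (2 * Real.sinh x)) ∧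
    (∀ A σ x : ℝ, 0 ≤ A → 0 ≤ σ → Real.log 2 ≤ x →
      A / Real.sinh x ≤
        σ * (Real.exp (-(x / 2)) + Real.exp (x / 2)) - (Real.exp (x / 2) * σ - 2 * A) / (2 * Real.sinh x)) := by
  refine ⟨fun A σ x hA hσ hx => ?_, fun A σ x _hA hσ hx => ?_⟩
  · have hu : 7 / 6 ≤ Real.exp (x / 2) := by
      have h1 : Real.log (7 / 6) ≤ x / 2 := by linarith
      calc (7 : ℝ) / 6 = Real.exp (Real.log (7 / 6)) := (Real.exp_log (by norm_num)).symm
        _ ≤ Real.exp (x / 2) := Real.exp_le_exp.mpr h1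
    rw [Real.exp_neg, sinh_eq_half]
    exact region_three_core hA hσ hu
  · have hu : 2 ≤ Real.exp (x / 2) ^ 2 := by
      calc (2 : ℝ) = Real.exp (Real.log 2) := (Real.exp_log (by norm_num)).symm
        _ ≤ Real.exp x := Real.exp_le_exp.mpr hx
        _ = Real.exp (x / 2) ^ 2 := exp_eq_sq_half x
    rw [Real.exp_neg, sinh_eq_half]
    exact region_four_core hσ (Real.exp_pos _) hu

end Summit.RiemannHypothesis.RiemannHypothesis.Theorems.SignConeFarField

end
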